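import Summits.Ventures.CertifiedManyBodySolver.Observables.RungLeavesCoverageNdNiO2M22ResidualBundlesSlabs
import HarnessLib

/-!
# Ventures/CertifiedManyBodySolver — Observables/RungLeavesCoverageNdNiO2M22ResidualBundlesCut.lean

HONEST FRAMING: one-sided certified CEILINGS on the uniform flux stiffness on the DOWNFOLDED d⁹-nickelate box of record `boxNdSrNiO2E_M22`
(Nd₀.₈Sr₀.₂NiO₂; router/BOXES/NdNiO2.md «1BH+3BE», SCREENING-GRADE) — wording class (xx1): CONTROL / CALIBRATION + labelled heuristic; a ceiling never
speaks to the presence or absence of superconductivity; never «certified true negative / positive»; not a `T_c` or phase-diagram statement; nothing here is a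
statement about Nd₀.₈Sr₀.₂NiO₂ samples; no rung leaf, item or summit statement is proved here. CONDITIONAL closers only (conditional BY NAME on the bundle rows and
cap tables named); floors and the `Q`-objective rows discharged inside (kernel theorems); no number of record; no `sorry`; no definition; zero compute.
Label (captain hubbard-cov-ndnio2-plan-1 g3): readiness plumbing / insurance, CONDITIONAL by name on rows not yet solved; count-neutral; no route opened here.

Cells `pub/hubbard-obs` ∧ `pub/hubbard-downfold` (MO-S2 ∧ MO-S1, D-0154 (1)(C) COVERAGE material (iii) NdNiO₂, column M22), seat `hubbard-cov-ndnio2-unc-3`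
(`prover-hubbard-cov-ndnio2-unc-3-g5-0`). Third part of the M22 funnel (`…M22ResidualBundles.lean` p663366 one slab / `…Slabs.lean` p664683 cut 13/2). THE CUT-110/21
EDITION (captain RULING hubbard-obs STATUS 2026-08-28T23:30:03Z «SLAB CUT U₁ = 110/21 ADOPTED FOR THE UNBORN ROUTE», on this seat's datum 23:17:42Z): the station-5
transport needs sources `s ∈ [σ(2 − 5/U_max), σ(2 − 5/U)]`, and `(−11/25)(2 − 5/U) ≤ −23/50 ⟺ U ≥ 110/21` EXACTLY — so the route «CovNdNiO2M22» is born with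
`ResidualHighUSlab22 := ∀ U ∈ Icc (110/21) (17/2) …` (rows A + B only) and `ResidualLowUSlab22 := ∀ U ∈ Icc 5 (110/21) …` (sources `[23σ/22, σ] ⊂ B ∪ C`: rows B + C
only); node counts 2 / 2. This file types both slab statements in the closers' currency (a separate module only to respect the 400-line rule):

* §6 HIGH `U ∈ [110/21, 17/2]` from rows A + B (B on its FULL segment `[−11/20, −23/50]`): `ndM22_station5_twoRowSlab_segment_ends` (−276/425, −23/50),
  `ndM22_residualTwoRowSlab_of_bundleRowsWN` (four rows + windows + 12 prices; unc-2's `…on_highSlab…` with `(U_A, U₁, U_max) = (5, 110/21, 17/2)`),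
  `ndM22_residualTwoRowSlab_of_PbundleRowsWN_capTables` (TWO `P` rows A, B; `Q` by `ndM22_QRowWN_kinematic`), literals (137/147 of the U range).
* §7 LOW `U ∈ [5, 110/21]` from rows B + C (B used on `[−529/1100, −23/50]`, C on its full segment): `ndM22_station5_lowSliver_segment_end` (`(−23/50)(23/22) = −529/1100`),
  `ndM22_station5_family2BC_of_bundleRowsWN` (two pieces switched at `s = −23/50`), `ndM22_residualLowSliver_of_bundleRowsWN` (box-1's
  `ObsStiffnessSeqCeilingAt_on_box3_of_apexStation_twoEndObjectives` with `(U_A, U_max) = (5, 110/21)`), `ndM22_residualLowSliver_of_PbundleRowsWN_capTables` (TWO `P` rows B, C).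

NOT said: that any M22 bundle certificate exists (hub words H1 0.4299543 / H3 0.4173548 certified 2026-08-28T23:15Z/23:24Z are INPUTS, not rows; spokes S1/S2 solving, S3 held);
a number of record. With the nodes typed, each crux is ONE `exact` — CLOSED MODULO TWO NODES each, never ‹proved› while the rows are claims.

References: Boyd–Vandenberghe, *Convex Optimization* (2004) §5.9 [BoydVandenberghe2004]; Koma–Tasaki, J. Stat. Phys. 76 (1994) 745, §1 [KomaTasaki1994];
Scalapino–White–Zhang, PRB 47 (1993) 7995, §II [ScalapinoWhiteZhang1993]; Lieb–Loss, Duke Math. J. 71 (1993) 337, §8 Thm 8.2 [LiebLoss1993]; Israel, *Convexity in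
the Theory of Lattice Gases* (1979) Thm. I.3.4 [Israel1979]; Hazra–Verma–Randeria, PRX 9 (2019) 031049, eq. (4) [HazraVermaRanderia2019].
-/

noncomputable section

namespace Summit.Ventures.CertifiedManyBodySolver.Observables

open Set Filter Topology
open Summit.Ventures.CertifiedManyBodySolver.Downfold
open Summit.Ventures.CertifiedManyBodySolver.Certificates
open Literature.MathematicalPhysics.QuantumLattice Literature.MathematicalPhysics.QuantumLattice.ThermodynamicLimit
open Literature.Probability.LatticeModels
open Matrix HubbardWave0
open scoped BigOperators ComplexOrder

/-! ## §6 The TWO-ROW slab `U ∈ [110/21, 17/2]` = the HIGH crux of the cut-110/21 route (rows A + B on their full segments) -/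

section TwoRowSlab22

/-- The station-5 two-row slab ends: `(−23/50)(2 − 5/(17/2)) = −276/425` and `(−11/25)(2 − 5/(110/21)) = −23/50` — for every target slot `σ ∈ [−23/50, −11/25]`
and every `U ≥ 110/21` the apex-station sources `s ∈ [σ(2 − 5/U_max), σ(2 − 5/U)]` lie in `[−276/425, −23/50] = A ∪ B`. [folklore] -/
theorem ndM22_station5_twoRowSlab_segment_ends :
    (-23 / 50 : ℝ) * (2 - (5 : ℝ) / (17 / 2 : ℝ)) = -(276 / 425) ∧ (-11 / 25 : ℝ) * (2 - (5 : ℝ) / (110 / 21 : ℝ)) = -23 / 50 := by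
  constructor <;> norm_num

/-- **CONDITIONAL CLOSER OF THE M22 TWO-ROW SLAB `U ∈ [110/21, 17/2]` FROM FOUR BUNDLE ROWS** (station `U_A = 5`, `U₁ = 110/21`, `U_max = 17/2`, sources
`[−276/425, −23/50] = A ∪ B`, anchor `409/500`): rows `P`/`Q` on A `[sA₁, sA₂] ⊇ [−276/425, −11/20]` and B `⊇ [−11/20, −23/50]` (B on its FULL segment); windows as
∀-hypotheses on the used rectangles; 12 end prices `≤ c` ⇒ `∀ tp ∈ [−23/50, −11/25], ∀ U ∈ [110/21, 17/2], ∀ n ∈ [393/500, 409/500], ObsStiffnessSeqCeilingAt tp U n c`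
(unc-2's `ObsStiffnessSeqCeilingAt_on_highSlab_of_apexStation_twoEndObjectives` per density). The kit's `ResidualHighUSlab22` slab `[13/2, 17/2]` and every `[U₁, 17/2]` with
`U₁ ≥ 110/21` follow by restriction; only `U ∈ [5, 110/21]` needs the C row. CONDITIONAL on the rows and windows; no number asserted.
[cite: KomaTasaki1994, §1] [cite: ScalapinoWhiteZhang1993, §II] [cite: HazraVermaRanderia2019, eq. (4)] -/
theorem ndM22_residualTwoRowSlab_of_bundleRowsWN {sA₁ sA₂ sB₁ sB₂ : ℝ}
    {loPA hiPA FPA sPA₁ sPA₂ loQA hiQA FQA sQA₁ sQA₂ loPB hiPB FPB sPB₁ sPB₂ loQB hiQB FQB sQB₁ sQB₂ c : ℚ}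
    (hPA : TPrimeBundleOrbitLowerRowWN 5 sA₁ sA₂ loPA hiPA FPA sPA₁ sPA₂ (409 / 500) (fun _ => -oddMomentObsTT (-23 / 50) 5 0))
    (hQA : TPrimeBundleOrbitLowerRowWN 5 sA₁ sA₂ loQA hiQA FQA sQA₁ sQA₂ (409 / 500) (fun _ => -oddMomentObsTT (-11 / 25) 5 0))
    (hPB : TPrimeBundleOrbitLowerRowWN 5 sB₁ sB₂ loPB hiPB FPB sPB₁ sPB₂ (409 / 500) (fun _ => -oddMomentObsTT (-23 / 50) 5 0))
    (hQB : TPrimeBundleOrbitLowerRowWN 5 sB₁ sB₂ loQB hiQB FQB sQB₁ sQB₂ (409 / 500) (fun _ => -oddMomentObsTT (-11 / 25) 5 0))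
    (hA₁ : sA₁ ≤ -(276 / 425)) (hA₂ : (-11 / 20 : ℝ) ≤ sA₂) (hB₁ : sB₁ ≤ -11 / 20) (hB₂ : (-23 / 50 : ℝ) ≤ sB₂)
    (hwinPA : ∀ s ∈ Set.Icc (-(276 / 425) : ℝ) (-11 / 20), ∀ x ∈ Set.Icc (393 / 500 : ℝ) (409 / 500),
      ((loPA : ℚ) : ℝ) ≤ energyDensityTT' 1 s 5 x ∧ energyDensityTT' 1 s 5 x ≤ ((hiPA : ℚ) : ℝ))
    (hwinQA : ∀ s ∈ Set.Icc (-(276 / 425) : ℝ) (-11 / 20), ∀ x ∈ Set.Icc (393 / 500 : ℝ) (409 / 500),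
      ((loQA : ℚ) : ℝ) ≤ energyDensityTT' 1 s 5 x ∧ energyDensityTT' 1 s 5 x ≤ ((hiQA : ℚ) : ℝ))
    (hwinPB : ∀ s ∈ Set.Icc (-11 / 20 : ℝ) (-23 / 50), ∀ x ∈ Set.Icc (393 / 500 : ℝ) (409 / 500),
      ((loPB : ℚ) : ℝ) ≤ energyDensityTT' 1 s 5 x ∧ energyDensityTT' 1 s 5 x ≤ ((hiPB : ℚ) : ℝ))
    (hwinQB : ∀ s ∈ Set.Icc (-11 / 20 : ℝ) (-23 / 50), ∀ x ∈ Set.Icc (393 / 500 : ℝ) (409 / 500),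
      ((loQB : ℚ) : ℝ) ≤ energyDensityTT' 1 s 5 x ∧ energyDensityTT' 1 s 5 x ≤ ((hiQB : ℚ) : ℝ))
    (pPA : -FPA - sPA₁ * (393 / 500 - 409 / 500) ≤ c ∧ -FPA - sPA₂ * (393 / 500 - 409 / 500) ≤ c ∧ -FPA ≤ c)
    (pQA : -FQA - sQA₁ * (393 / 500 - 409 / 500) ≤ c ∧ -FQA - sQA₂ * (393 / 500 - 409 / 500) ≤ c ∧ -FQA ≤ c)
    (pPB : -FPB - sPB₁ * (393 / 500 - 409 / 500) ≤ c ∧ -FPB - sPB₂ * (393 / 500 - 409 / 500) ≤ c ∧ -FPB ≤ c)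
    (pQB : -FQB - sQB₁ * (393 / 500 - 409 / 500) ≤ c ∧ -FQB - sQB₂ * (393 / 500 - 409 / 500) ≤ c ∧ -FQB ≤ c) :
    ∀ tp ∈ Set.Icc (-23 / 50 : ℝ) (-11 / 25), ∀ U ∈ Set.Icc (110 / 21 : ℝ) (17 / 2), ∀ n ∈ Set.Icc (393 / 500 : ℝ) (409 / 500),
      ObsStiffnessSeqCeilingAt tp U n c := by
  intro tp htp U hU n hn
  obtain ⟨eL, eR⟩ := ndM22_station5_twoRowSlab_segment_ends
  have fP := ndM22_station5_family2_of_bundleRowsWN (-23 / 50) hPA hPB hA₁ hA₂ hB₁ hB₂ hwinPA hwinPB n hn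
  have fQ := ndM22_station5_family2_of_bundleRowsWN (-11 / 25) hQA hQB hA₁ hA₂ hB₁ hB₂ hwinQA hwinQB n hn
  have cPA := neg_wnBundleValue_le_on_R22_of_ends pPA.1 pPA.2.1 pPA.2.2 n hn
  have cQA := neg_wnBundleValue_le_on_R22_of_ends pQA.1 pQA.2.1 pQA.2.2 n hn
  have cPB := neg_wnBundleValue_le_on_R22_of_ends pPB.1 pPB.2.1 pPB.2.2 n hn
  have cQB := neg_wnBundleValue_le_on_R22_of_ends pQB.1 pQB.2.1 pQB.2.2 n hn
  refine ObsStiffnessSeqCeilingAt_on_highSlab_of_apexStation_twoEndObjectives (p := -23 / 50) (q := -11 / 25) (UA := (5 : ℝ))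
    (U₁ := (110 / 21 : ℝ)) (Umax := (17 / 2 : ℝ)) (n := n) (by norm_num) (by norm_num) (by norm_num) (by norm_num)
    (by linarith [hn.1]) (by linarith [hn.2])
    (fun s => if s ≤ -11 / 20 then wnBundleValue FPA sPA₁ sPA₂ (409 / 500) n else wnBundleValue FPB sPB₁ sPB₂ (409 / 500) n)
    (fun s => if s ≤ -11 / 20 then wnBundleValue FQA sQA₁ sQA₂ (409 / 500) n else wnBundleValue FQB sQB₁ sQB₂ (409 / 500) n)
    c ?_ ?_ ?_ tp htp U hU
  · intro s hs
    rw [eL, eR] at hs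
    exact fP s hs
  · intro s hs
    rw [eL, eR] at hs
    exact fQ s hs
  · intro σ hσ s _
    refine neg_slotChord_le_of_neg_le (by norm_num) hσ ?_ ?_
    · by_cases hs1 : s ≤ -11 / 20
      · simp only [if_pos hs1]; exact cPA
      · simp only [if_neg hs1]; exact cPB
    · by_cases hs1 : s ≤ -11 / 20
      · simp only [if_pos hs1]; exact cQA
      · simp only [if_neg hs1]; exact cQB

/-- **THE M22 TWO-ROW SLAB `U ∈ [110/21, 17/2]` FROM THE TWO `P` BUNDLE ROWS A AND B** (cap TABLES in binder shape, `Q` slots by `ndM22_QRowWN_kinematic`, floors §1):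
`P` rows on A `⊇ [−276/425, −11/20]` / B `⊇ [−11/20, −23/50]` anchored at `409/500` + two cap tables (`nX ≤ 393/500 ≤ 409/500 ≤ nTX`) + `lo ≤ −112884/53125 | −4499/2500`,
`CX ≤ hi` + the two `P` price triples `≤ c` + `4418570/10⁷ ≤ c` ⇒ `∀ tp ∈ [−23/50, −11/25], ∀ U ∈ [110/21, 17/2], ∀ n ∈ [393/500, 409/500], ObsStiffnessSeqCeilingAt tp U n c`.
With two bundle claim nodes this is 93 % of the U range of the residual cell, modulo nodes. [cite: KomaTasaki1994, §1] [cite: ScalapinoWhiteZhang1993, §II]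
[cite: LiebLoss1993, §8, Theorem 8.2] -/
theorem ndM22_residualTwoRowSlab_of_PbundleRowsWN_capTables {sA₁ sA₂ sB₁ sB₂ aA bA nA nTA CA aB bB nB nTB CB : ℝ}
    {loPA hiPA FPA sPA₁ sPA₂ loPB hiPB FPB sPB₁ sPB₂ c : ℚ}
    (hPA : TPrimeBundleOrbitLowerRowWN 5 sA₁ sA₂ loPA hiPA FPA sPA₁ sPA₂ (409 / 500) (fun _ => -oddMomentObsTT (-23 / 50) 5 0))
    (hPB : TPrimeBundleOrbitLowerRowWN 5 sB₁ sB₂ loPB hiPB FPB sPB₁ sPB₂ (409 / 500) (fun _ => -oddMomentObsTT (-23 / 50) 5 0))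
    (hA₁ : sA₁ ≤ -(276 / 425)) (hA₂ : (-11 / 20 : ℝ) ≤ sA₂) (hB₁ : sB₁ ≤ -11 / 20) (hB₂ : (-23 / 50 : ℝ) ≤ sB₂)
    (hcapA : ∀ U s n : ℝ, 0 ≤ U → U ≤ 5 → aA ≤ s → s ≤ bA → nA ≤ n → n ≤ nTA → energyDensityTT' 1 s U n ≤ CA)
    (hcapB : ∀ U s n : ℝ, 0 ≤ U → U ≤ 5 → aB ≤ s → s ≤ bB → nB ≤ n → n ≤ nTB → energyDensityTT' 1 s U n ≤ CB)
    (haA : aA ≤ -(276 / 425)) (hbA : (-11 / 20 : ℝ) ≤ bA) (hnA : nA ≤ 393 / 500) (hnTA : (409 / 500 : ℝ) ≤ nTA)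
    (haB : aB ≤ -11 / 20) (hbB : (-23 / 50 : ℝ) ≤ bB) (hnB : nB ≤ 393 / 500) (hnTB : (409 / 500 : ℝ) ≤ nTB)
    (hloPA : loPA ≤ -112884 / 53125) (hloPB : loPB ≤ -4499 / 2500)
    (hhiPA : CA ≤ ((hiPA : ℚ) : ℝ)) (hhiPB : CB ≤ ((hiPB : ℚ) : ℝ))
    (pPA : -FPA - sPA₁ * (393 / 500 - 409 / 500) ≤ c ∧ -FPA - sPA₂ * (393 / 500 - 409 / 500) ≤ c ∧ -FPA ≤ c)
    (pPB : -FPB - sPB₁ * (393 / 500 - 409 / 500) ≤ c ∧ -FPB - sPB₂ * (393 / 500 - 409 / 500) ≤ c ∧ -FPB ≤ c)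
    (hcQ : (4418570 / 10000000 : ℚ) ≤ c) :
    ∀ tp ∈ Set.Icc (-23 / 50 : ℝ) (-11 / 25), ∀ U ∈ Set.Icc (110 / 21 : ℝ) (17 / 2), ∀ n ∈ Set.Icc (393 / 500 : ℝ) (409 / 500),
      ObsStiffnessSeqCeilingAt tp U n c := by
  have h5 : (0 : ℝ) ≤ 5 := by norm_num
  obtain ⟨flA, flB, -⟩ := ndM22_station5_rectFloors (U := (5 : ℝ)) h5
  exact ndM22_residualTwoRowSlab_of_bundleRowsWN hPA (ndM22_QRowWN_kinematic 5 sA₁ sA₂ loPA hiPA 5) hPB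
    (ndM22_QRowWN_kinematic 5 sB₁ sB₂ loPB hiPB 5) hA₁ hA₂ hB₁ hB₂
    (bundleWindow_of_capTable_R22 h5 hcapA haA hbA hnA hnTA flA hloPA hhiPA)
    (bundleWindow_of_capTable_R22 h5 hcapA haA hbA hnA hnTA flA hloPA hhiPA)
    (bundleWindow_of_capTable_R22 h5 hcapB haB hbB hnB hnTB flB hloPB hhiPB)
    (bundleWindow_of_capTable_R22 h5 hcapB haB hbB hnB hnTB flB hloPB hhiPB)
    pPA (ndM22_QRowWN_kinematic_prices_of_le hcQ) pPB (ndM22_QRowWN_kinematic_prices_of_le hcQ)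

/-- The two-row slab arithmetic (decidable): `110/21 = 5 + 5/21`, `5 ≤ 110/21 ≤ 13/2`, and the U-range fractions `(17/2 − 110/21)/(17/2 − 5) = 137/147` (two rows cover
`137/147 = 0.93197…` of `[5, 17/2]`) and `(13/2 − 110/21)/(13/2 − 5) = 53/63` (`= 0.84127` of the kit's low slab `[5, 13/2]`). [folklore] -/
theorem ndM22_twoRowSlab_literals :
    ((110 / 21 : ℚ) = 5 + 5 / 21) ∧ ((5 : ℚ) ≤ 110 / 21) ∧ ((110 / 21 : ℚ) ≤ 13 / 2) ∧
    (((17 / 2 : ℚ) - 110 / 21) / (17 / 2 - 5) = 137 / 147) ∧ (((13 / 2 : ℚ) - 110 / 21) / (13 / 2 - 5) = 53 / 63) := by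
  norm_num

end TwoRowSlab22

/-! ## §7 The LOW sliver `U ∈ [5, 110/21]` = the LOW crux of the cut-110/21 route (rows B + C; sources `[23σ/22, σ] ⊂ B ∪ C`) -/

section LowSliver22

/-- The station-5 low-sliver far source: `(−23/50)(2 − 5/(110/21)) = (−23/50)(23/22) = −529/1100` (inside segment B `[−11/20, −23/50]`). [folklore] -/
theorem ndM22_station5_lowSliver_segment_end :
    (-23 / 50 : ℝ) * (2 - (5 : ℝ) / (110 / 21 : ℝ)) = -(529 / 1100) := by
  norm_num

/-- **TWO-PIECE FAMILY SWITCHED AT `s = −23/50` for one objective slot `σ`** (station `U_A = 5`, anchor `409/500`): bundle rows on `[sB₁, sB₂] ⊇ [a, −23/50]` and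
`[sC₁, sC₂] ⊇ [−23/50, b]` for `−X₀(σ, 5)`, windows DISCHARGED on (used segment) × R₂₂ ⇒ at every `x ∈ R₂₂`, `s ∈ [a, b]` the value
`if s ≤ −23/50 then wnBundleValue_B x else wnBundleValue_C x` is an orbit-LOWER bound on the torus-limit ground-state class at `(s, 5, x)`.
[cite: BoydVandenberghe2004, §5.9] [cite: KomaTasaki1994, §1] -/
theorem ndM22_station5_family2BC_of_bundleRowsWN (σ : ℝ) {a b sB₁ sB₂ sC₁ sC₂ : ℝ} {loB hiB FB slB₁ slB₂ loC hiC FC slC₁ slC₂ : ℚ}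
    (hB : TPrimeBundleOrbitLowerRowWN 5 sB₁ sB₂ loB hiB FB slB₁ slB₂ (409 / 500) (fun _ => -oddMomentObsTT σ 5 0))
    (hC : TPrimeBundleOrbitLowerRowWN 5 sC₁ sC₂ loC hiC FC slC₁ slC₂ (409 / 500) (fun _ => -oddMomentObsTT σ 5 0))
    (haB : sB₁ ≤ a) (hB₂ : (-23 / 50 : ℝ) ≤ sB₂) (hC₁ : sC₁ ≤ -23 / 50) (hbC : b ≤ sC₂)
    (hwinB : ∀ s ∈ Set.Icc a (-23 / 50), ∀ x ∈ Set.Icc (393 / 500 : ℝ) (409 / 500),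
      ((loB : ℚ) : ℝ) ≤ energyDensityTT' 1 s 5 x ∧ energyDensityTT' 1 s 5 x ≤ ((hiB : ℚ) : ℝ))
    (hwinC : ∀ s ∈ Set.Icc (-23 / 50 : ℝ) b, ∀ x ∈ Set.Icc (393 / 500 : ℝ) (409 / 500),
      ((loC : ℚ) : ℝ) ≤ energyDensityTT' 1 s 5 x ∧ energyDensityTT' 1 s 5 x ≤ ((hiC : ℚ) : ℝ)) :
    ∀ x ∈ Set.Icc (393 / 500 : ℝ) (409 / 500), ∀ s ∈ Set.Icc a b,
      ∀ (ω : InfVolFermionState 2) (Ls : ℕ → ℕ) (ψ : ∀ L, Fock (Orb (FermionTorus 2 L))),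
      Tendsto Ls atTop atTop →
      (∀ j, IsGroundStateInSector (hubbardTorusTT' (Ls j) 1 s 5) (rectN x (Ls j)) 0 (ψ (Ls j))) →
      (∀ j, star (ψ (Ls j)) ⬝ᵥ ψ (Ls j) = 1) → ω.IsTorusLimitOf ψ Ls →
      (if s ≤ -23 / 50 then wnBundleValue FB slB₁ slB₂ (409 / 500) x else wnBundleValue FC slC₁ slC₂ (409 / 500) x) ≤
        ((Finset.univ : Finset (DihedralGroup 4)).card : ℝ)⁻¹ * ∑ g ∈ (Finset.univ : Finset (DihedralGroup 4)),
          (ω.expect (d4ShiftSet g 0 (Literature.Probability.LatticeModels.box 2 7))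
            (fermionEmbed (PolySite.d4Emb g 0 (Literature.Probability.LatticeModels.box 2 7)) (-oddMomentObsTT σ 5 0))).re := by
  intro x hx s hs ω Ls ψ hLs hψ h1 hω
  have fB := orbitLowerOn_subrect_of_bundleRowWN hB haB hB₂ (by norm_num : (0 : ℝ) ≤ 393 / 500) (by norm_num : (409 / 500 : ℝ) < 2) hwinB
  have fC := orbitLowerOn_subrect_of_bundleRowWN hC hC₁ hbC (by norm_num : (0 : ℝ) ≤ 393 / 500) (by norm_num : (409 / 500 : ℝ) < 2) hwinC
  by_cases hs1 : s ≤ -23 / 50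
  · simp only [if_pos hs1]
    exact fB x hx s ⟨hs.1, hs1⟩ ω Ls ψ hLs hψ h1 hω
  · simp only [if_neg hs1]
    exact fC x hx s ⟨(not_le.1 hs1).le, hs.2⟩ ω Ls ψ hLs hψ h1 hω

/-- **CONDITIONAL CLOSER OF THE M22 LOW SLIVER `U ∈ [5, 110/21]` FROM FOUR BUNDLE ROWS** (station `U_A = 5`, `U_max = 110/21`, sources `[−529/1100, −11/25] ⊂ B ∪ C`,
anchor `409/500`): rows `P`/`Q` on B `[sB₁, sB₂] ⊇ [−529/1100, −23/50]` and C `⊇ [−23/50, −11/25]`; windows as ∀-hypotheses on the used rectangles; 12 end prices `≤ c` ⇒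
`∀ tp ∈ [−23/50, −11/25], ∀ U ∈ [5, 110/21], ∀ n ∈ [393/500, 409/500], ObsStiffnessSeqCeilingAt tp U n c` (box-1's `ObsStiffnessSeqCeilingAt_on_box3_of_apexStation_twoEndObjectives`
with `(U_A, U_max) = (5, 110/21)`). CONDITIONAL on the rows and windows; no number asserted. [cite: KomaTasaki1994, §1] [cite: ScalapinoWhiteZhang1993, §II]
[cite: BoydVandenberghe2004, §5.9] -/
theorem ndM22_residualLowSliver_of_bundleRowsWN {sB₁ sB₂ sC₁ sC₂ : ℝ}
    {loPB hiPB FPB sPB₁ sPB₂ loQB hiQB FQB sQB₁ sQB₂ loPC hiPC FPC sPC₁ sPC₂ loQC hiQC FQC sQC₁ sQC₂ c : ℚ}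
    (hPB : TPrimeBundleOrbitLowerRowWN 5 sB₁ sB₂ loPB hiPB FPB sPB₁ sPB₂ (409 / 500) (fun _ => -oddMomentObsTT (-23 / 50) 5 0))
    (hQB : TPrimeBundleOrbitLowerRowWN 5 sB₁ sB₂ loQB hiQB FQB sQB₁ sQB₂ (409 / 500) (fun _ => -oddMomentObsTT (-11 / 25) 5 0))
    (hPC : TPrimeBundleOrbitLowerRowWN 5 sC₁ sC₂ loPC hiPC FPC sPC₁ sPC₂ (409 / 500) (fun _ => -oddMomentObsTT (-23 / 50) 5 0))
    (hQC : TPrimeBundleOrbitLowerRowWN 5 sC₁ sC₂ loQC hiQC FQC sQC₁ sQC₂ (409 / 500) (fun _ => -oddMomentObsTT (-11 / 25) 5 0))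
    (hB₁ : sB₁ ≤ -(529 / 1100)) (hB₂ : (-23 / 50 : ℝ) ≤ sB₂) (hC₁ : sC₁ ≤ -23 / 50) (hC₂ : (-11 / 25 : ℝ) ≤ sC₂)
    (hwinPB : ∀ s ∈ Set.Icc (-(529 / 1100) : ℝ) (-23 / 50), ∀ x ∈ Set.Icc (393 / 500 : ℝ) (409 / 500),
      ((loPB : ℚ) : ℝ) ≤ energyDensityTT' 1 s 5 x ∧ energyDensityTT' 1 s 5 x ≤ ((hiPB : ℚ) : ℝ))
    (hwinQB : ∀ s ∈ Set.Icc (-(529 / 1100) : ℝ) (-23 / 50), ∀ x ∈ Set.Icc (393 / 500 : ℝ) (409 / 500),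
      ((loQB : ℚ) : ℝ) ≤ energyDensityTT' 1 s 5 x ∧ energyDensityTT' 1 s 5 x ≤ ((hiQB : ℚ) : ℝ))
    (hwinPC : ∀ s ∈ Set.Icc (-23 / 50 : ℝ) (-11 / 25), ∀ x ∈ Set.Icc (393 / 500 : ℝ) (409 / 500),
      ((loPC : ℚ) : ℝ) ≤ energyDensityTT' 1 s 5 x ∧ energyDensityTT' 1 s 5 x ≤ ((hiPC : ℚ) : ℝ))
    (hwinQC : ∀ s ∈ Set.Icc (-23 / 50 : ℝ) (-11 / 25), ∀ x ∈ Set.Icc (393 / 500 : ℝ) (409 / 500),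
      ((loQC : ℚ) : ℝ) ≤ energyDensityTT' 1 s 5 x ∧ energyDensityTT' 1 s 5 x ≤ ((hiQC : ℚ) : ℝ))
    (pPB : -FPB - sPB₁ * (393 / 500 - 409 / 500) ≤ c ∧ -FPB - sPB₂ * (393 / 500 - 409 / 500) ≤ c ∧ -FPB ≤ c)
    (pQB : -FQB - sQB₁ * (393 / 500 - 409 / 500) ≤ c ∧ -FQB - sQB₂ * (393 / 500 - 409 / 500) ≤ c ∧ -FQB ≤ c)
    (pPC : -FPC - sPC₁ * (393 / 500 - 409 / 500) ≤ c ∧ -FPC - sPC₂ * (393 / 500 - 409 / 500) ≤ c ∧ -FPC ≤ c)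
    (pQC : -FQC - sQC₁ * (393 / 500 - 409 / 500) ≤ c ∧ -FQC - sQC₂ * (393 / 500 - 409 / 500) ≤ c ∧ -FQC ≤ c) :
    ∀ tp ∈ Set.Icc (-23 / 50 : ℝ) (-11 / 25), ∀ U ∈ Set.Icc (5 : ℝ) (110 / 21), ∀ n ∈ Set.Icc (393 / 500 : ℝ) (409 / 500),
      ObsStiffnessSeqCeilingAt tp U n c := by
  have eS := ndM22_station5_lowSliver_segment_end
  have fP := ndM22_station5_family2BC_of_bundleRowsWN (-23 / 50) hPB hPC hB₁ hB₂ hC₁ hC₂ hwinPB hwinPC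
  have fQ := ndM22_station5_family2BC_of_bundleRowsWN (-11 / 25) hQB hQC hB₁ hB₂ hC₁ hC₂ hwinQB hwinQC
  refine ObsStiffnessSeqCeilingAt_on_box3_of_apexStation_twoEndObjectives (p := -23 / 50) (q := -11 / 25) (UA := (5 : ℝ))
    (Umax := (110 / 21 : ℝ)) (n₁ := 393 / 500) (n₂ := 409 / 500) (by norm_num) (by norm_num) (by norm_num) (by norm_num) (by norm_num)
    (fun x s => if s ≤ -23 / 50 then wnBundleValue FPB sPB₁ sPB₂ (409 / 500) x else wnBundleValue FPC sPC₁ sPC₂ (409 / 500) x)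
    (fun x s => if s ≤ -23 / 50 then wnBundleValue FQB sQB₁ sQB₂ (409 / 500) x else wnBundleValue FQC sQC₁ sQC₂ (409 / 500) x)
    c (fun x hx s hs => fP x hx s (by rw [eS] at hs; exact hs)) (fun x hx s hs => fQ x hx s (by rw [eS] at hs; exact hs)) ?_
  intro x hx σ hσ s _
  refine neg_slotChord_le_of_neg_le (by norm_num) hσ ?_ ?_
  · by_cases hs1 : s ≤ -23 / 50
    · simp only [if_pos hs1]; exact neg_wnBundleValue_le_on_R22_of_ends pPB.1 pPB.2.1 pPB.2.2 x hx
    · simp only [if_neg hs1]; exact neg_wnBundleValue_le_on_R22_of_ends pPC.1 pPC.2.1 pPC.2.2 x hx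
  · by_cases hs1 : s ≤ -23 / 50
    · simp only [if_pos hs1]; exact neg_wnBundleValue_le_on_R22_of_ends pQB.1 pQB.2.1 pQB.2.2 x hx
    · simp only [if_neg hs1]; exact neg_wnBundleValue_le_on_R22_of_ends pQC.1 pQC.2.1 pQC.2.2 x hx

/-- **THE M22 LOW SLIVER `U ∈ [5, 110/21]` FROM THE TWO `P` BUNDLE ROWS B AND C** (cap TABLES in binder shape, `Q` slots by `ndM22_QRowWN_kinematic`, floors part 1 §1):
`P` rows on B `⊇ [−529/1100, −23/50]` (any B row on `[−11/20, −23/50]` qualifies: `−11/20 ≤ −529/1100`) / C `⊇ [−23/50, −11/25]` anchored at `409/500` + two cap tables on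
`[aB, bB] ⊇ [−529/1100, −23/50]`, `[aC, bC] ⊇ [−23/50, −11/25]` (`nX ≤ 393/500 ≤ 409/500 ≤ nTX`) + `lo ≤ −4499/2500 | −5726/3125`, `CX ≤ hi` + the two `P` price triples `≤ c`
+ `4418570/10⁷ ≤ c` ⇒ `∀ tp ∈ [−23/50, −11/25], ∀ U ∈ [5, 110/21], ∀ n ∈ [393/500, 409/500], ObsStiffnessSeqCeilingAt tp U n c` — the LOW crux of the cut route by ONE `exact`
with two bundle claim nodes. [cite: KomaTasaki1994, §1] [cite: ScalapinoWhiteZhang1993, §II] [cite: LiebLoss1993, §8, Theorem 8.2] -/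
theorem ndM22_residualLowSliver_of_PbundleRowsWN_capTables {sB₁ sB₂ sC₁ sC₂ aB bB nB nTB CB aC bC nC nTC CC : ℝ}
    {loPB hiPB FPB sPB₁ sPB₂ loPC hiPC FPC sPC₁ sPC₂ c : ℚ}
    (hPB : TPrimeBundleOrbitLowerRowWN 5 sB₁ sB₂ loPB hiPB FPB sPB₁ sPB₂ (409 / 500) (fun _ => -oddMomentObsTT (-23 / 50) 5 0))
    (hPC : TPrimeBundleOrbitLowerRowWN 5 sC₁ sC₂ loPC hiPC FPC sPC₁ sPC₂ (409 / 500) (fun _ => -oddMomentObsTT (-23 / 50) 5 0))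
    (hB₁ : sB₁ ≤ -(529 / 1100)) (hB₂ : (-23 / 50 : ℝ) ≤ sB₂) (hC₁ : sC₁ ≤ -23 / 50) (hC₂ : (-11 / 25 : ℝ) ≤ sC₂)
    (hcapB : ∀ U s n : ℝ, 0 ≤ U → U ≤ 5 → aB ≤ s → s ≤ bB → nB ≤ n → n ≤ nTB → energyDensityTT' 1 s U n ≤ CB)
    (hcapC : ∀ U s n : ℝ, 0 ≤ U → U ≤ 5 → aC ≤ s → s ≤ bC → nC ≤ n → n ≤ nTC → energyDensityTT' 1 s U n ≤ CC)
    (haB : aB ≤ -(529 / 1100)) (hbB : (-23 / 50 : ℝ) ≤ bB) (hnB : nB ≤ 393 / 500) (hnTB : (409 / 500 : ℝ) ≤ nTB)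
    (haC : aC ≤ -23 / 50) (hbC : (-11 / 25 : ℝ) ≤ bC) (hnC : nC ≤ 393 / 500) (hnTC : (409 / 500 : ℝ) ≤ nTC)
    (hloPB : loPB ≤ -4499 / 2500) (hloPC : loPC ≤ -5726 / 3125)
    (hhiPB : CB ≤ ((hiPB : ℚ) : ℝ)) (hhiPC : CC ≤ ((hiPC : ℚ) : ℝ))
    (pPB : -FPB - sPB₁ * (393 / 500 - 409 / 500) ≤ c ∧ -FPB - sPB₂ * (393 / 500 - 409 / 500) ≤ c ∧ -FPB ≤ c)
    (pPC : -FPC - sPC₁ * (393 / 500 - 409 / 500) ≤ c ∧ -FPC - sPC₂ * (393 / 500 - 409 / 500) ≤ c ∧ -FPC ≤ c)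
    (hcQ : (4418570 / 10000000 : ℚ) ≤ c) :
    ∀ tp ∈ Set.Icc (-23 / 50 : ℝ) (-11 / 25), ∀ U ∈ Set.Icc (5 : ℝ) (110 / 21), ∀ n ∈ Set.Icc (393 / 500 : ℝ) (409 / 500),
      ObsStiffnessSeqCeilingAt tp U n c := by
  have h5 : (0 : ℝ) ≤ 5 := by norm_num
  obtain ⟨-, flB, flC⟩ := ndM22_station5_rectFloors (U := (5 : ℝ)) h5
  have flB' : ∀ s ∈ Set.Icc (-(529 / 1100) : ℝ) (-23 / 50), ∀ x ∈ Set.Icc (393 / 500 : ℝ) (409 / 500),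
      (((-4499 / 2500 : ℚ)) : ℝ) ≤ energyDensityTT' 1 s 5 x :=
    fun s hs x hx => flB s ⟨le_trans (by norm_num) hs.1, hs.2⟩ x hx
  exact ndM22_residualLowSliver_of_bundleRowsWN hPB (ndM22_QRowWN_kinematic 5 sB₁ sB₂ loPB hiPB 5) hPC
    (ndM22_QRowWN_kinematic 5 sC₁ sC₂ loPC hiPC 5) hB₁ hB₂ hC₁ hC₂
    (bundleWindow_of_capTable_R22 h5 hcapB haB hbB hnB hnTB flB' hloPB hhiPB)
    (bundleWindow_of_capTable_R22 h5 hcapB haB hbB hnB hnTB flB' hloPB hhiPB)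
    (bundleWindow_of_capTable_R22 h5 hcapC haC hbC hnC hnTC flC hloPC hhiPC)
    (bundleWindow_of_capTable_R22 h5 hcapC haC hbC hnC hnTC flC hloPC hhiPC)
    pPB (ndM22_QRowWN_kinematic_prices_of_le hcQ) pPC (ndM22_QRowWN_kinematic_prices_of_le hcQ)

/-- The low-sliver arithmetic (decidable): `2 − 5/(110/21) = 23/22`, `−11/20 ≤ −529/1100 ≤ −23/50` (the far source sits inside segment B), and
`(110/21 − 5)/(17/2 − 5) = 10/147` of the U range. [folklore] -/
theorem ndM22_lowSliver_literals :
    ((2 : ℚ) - 5 / (110 / 21) = 23 / 22) ∧ ((-11 / 20 : ℚ) ≤ -(529 / 1100)) ∧ ((-(529 / 1100) : ℚ) ≤ -23 / 50) ∧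
    (((110 / 21 : ℚ) - 5) / (17 / 2 - 5) = 10 / 147) := by
  norm_num

end LowSliver22

end Summit.Ventures.CertifiedManyBodySolver.Observables

end
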